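import Summits.CriticalPhenomena.PercolationContinuityZ3.Theorems.PercNearOneGluingNoHeavyPcintKernZ5S4Defs
import HarnessLib

/-!
# PCINT lane, kernel check 2/2 of the B2r window certificate `d = 5`, memory 4 (3-step windows, 1000 codes): codes `500 ≤ c < 1000`

Cell `prim-pcint`, seat `prim-pcint-2` (gen 2).  Collatz–Wielandt rows `10^5 · row ≤ 99999 · DEN · v` for the window codes in
`[500, 1000)`, by `decide +kernel` in chunks of `100` codes (natural-number arithmetic only; `maxHeartbeats 0`).
Does NOT build on p205010.
-/

namespace Summit.CriticalPhenomena.PercolationContinuityZ3.Theorems.Pcint.Z5S4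

set_option maxHeartbeats 0 in
/-- Rows `500 ≤ c < 600` of the certificate hold. [folklore] -/
theorem chk_500_600 : chk 500 600 = true := by decide +kernel

set_option maxHeartbeats 0 in
/-- Rows `600 ≤ c < 700` of the certificate hold. [folklore] -/
theorem chk_600_700 : chk 600 700 = true := by decide +kernel

set_option maxHeartbeats 0 in
/-- Rows `700 ≤ c < 800` of the certificate hold. [folklore] -/
theorem chk_700_800 : chk 700 800 = true := by decide +kernel

set_option maxHeartbeats 0 in
/-- Rows `800 ≤ c < 900` of the certificate hold. [folklore] -/
theorem chk_800_900 : chk 800 900 = true := by decide +kernel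

set_option maxHeartbeats 0 in
/-- Rows `900 ≤ c < 1000` of the certificate hold. [folklore] -/
theorem chk_900_1000 : chk 900 1000 = true := by decide +kernel

/-- Rows `500 ≤ c < 1000` of the certificate hold. [folklore] -/
theorem chkFile_2 : chk 500 1000 = true :=
  chk_split (chk_split (chk_split (chk_split chk_500_600 chk_600_700) chk_700_800) chk_800_900) chk_900_1000

end Summit.CriticalPhenomena.PercolationContinuityZ3.Theorems.Pcint.Z5S4
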